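import Mathlib
import Literature.NumberTheory.LFunctions.Zhang2022.Section15ResidueInputs
import Literature.NumberTheory.LFunctions.Zhang2022.Section3Lemma31
import HarnessLib

/-!
# Zhang (2022), §15 (15.17): the size of `ℛ₁*` under (A) — `|ℛ₁*| ≪ 𝓛²`

Topic `Literature/NumberTheory/LFunctions/Zhang2022` (Landau–Siegel audit tree; verdict-neutral).
Y. Zhang, *Discrete mean estimates and the Landau–Siegel zero*, arXiv:2211.02515v1 (2022)
[Zhang2022LandauSiegel] — **an unrefereed manuscript under adjudication; nothing here asserts or denies
its Theorems 1–2.** The error bookkeeping of the (15.17) assembly ("Inserting this into (15.11) … we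
obtain (15.17) … + o(p)", §15 p. 85, tex L4226) multiplies the termwise errors of (15.15) by the prefactor
`ℛ₁*Dp/φ(D)` of (15.11), so it needs a polynomial bound on `ℛ₁* = L(1+β₁,χ)L(1+β₂,χ)δ(1)/L′(1,χ)`
(`Typed.Section15A.calR1star`, §15 p. 83 tex L4135). This file PROVES it from tree theorems:
§15.u058 ("`ℛ₁* = β₁β₂L′(1,χ) + O(𝓛⁻²⁴)`", `ResidueValues.step15_u058_inputs15AB`), `|β_j| ≤ 1` for
`𝓛` large and `|L′(1,χ)| ≤ 2e^{9/2}(1+𝓛)𝓛` (`Lemma31.norm_deriv_LFunction_le_near_one`):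

* `norm_calR1star_le` — `∃ C, ForAllLarge, (A) → ‖ℛ₁*‖ ≤ C𝓛²`;
* `norm_calR1star_le_pow` — the `∃ C k, … ≤ C𝓛ᵏ` form (hypothesis `hRs` of the (15.17) assembly edge).

Theorems only; no definitions, no facts; nothing about Landau–Siegel zeros.

## References

* Y. Zhang, arXiv:2211.02515v1 (2022), §15 p. 83 (tex L4135), p. 85 (15.17), p. 88 (§15.u058).
  [cite: Zhang2022LandauSiegel, §15 (15.17) p.85]
-/

noncomputable section

open Complex Real

namespace Literature.NumberTheory.LFunctions.Zhang2022.Typed.Section15A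

open Literature.NumberTheory.LFunctions.Zhang2022
open Literature.NumberTheory.LFunctions.Zhang2022.Skeleton

/-- For every `L₀` there is `D₀` with `𝓛 = log D ≥ L₀` for `D ≥ D₀`. [folklore] -/
private theorem exists_nat_ell_ge (L₀ : ℝ) :
    ∃ D₀ : ℕ, ∀ D : ℕ, D₀ ≤ D → L₀ ≤ ell D := by
  refine ⟨⌈Real.exp L₀⌉₊ + 1, fun D hD => ?_⟩
  have h1 : Real.exp L₀ ≤ D := by
    have : (⌈Real.exp L₀⌉₊ : ℝ) + 1 ≤ D := by exact_mod_cast hD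
    linarith [Nat.le_ceil (Real.exp L₀)]
  have hD0 : (0 : ℝ) < D := lt_of_lt_of_le (Real.exp_pos L₀) h1
  unfold ell
  rw [Real.le_log_iff_exp_le hD0]
  exact h1

/-- For `𝓛 ≥ 4` and `𝓛 ≥ |c′|`: `‖β₁‖ ≤ 1` and `‖β₂‖ ≤ 1` (`β₁ = iα(1−5c′α𝓛)`, `β₂ = 2iα(1+c′α𝓛)`,
`α = π/𝓛⁹`). [cite: Zhang2022LandauSiegel, §2 (2.13)] -/
private theorem norm_beta12_le_one (c' : ℝ) {D : ℕ} (hℓ4 : 4 ≤ ell D) (hℓc : |c'| ≤ ell D) :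
    ‖beta1 c' D‖ ≤ 1 ∧ ‖beta2 c' D‖ ≤ 1 := by
  set ℓ := ell D with hℓ
  have hℓ0 : 0 < ℓ := by linarith
  have hα : alpha D = Real.pi / ℓ ^ 9 := by unfold alpha bigP; rw [Real.log_exp]
  have hα0 : 0 ≤ alpha D := by rw [hα]; positivity
  have hπ : Real.pi ≤ 4 := Real.pi_le_four
  have hℓ9 : (4 : ℝ) ^ 9 ≤ ℓ ^ 9 := pow_le_pow_left₀ (by norm_num) hℓ4 9
  have hα1 : alpha D ≤ 4 / 4 ^ 9 := by
    rw [hα]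
    calc Real.pi / ℓ ^ 9 ≤ 4 / ℓ ^ 9 := by gcongr
      _ ≤ 4 / 4 ^ 9 := by gcongr
  have hcαℓ : |c'| * alpha D * ℓ ≤ 4 / 4 ^ 7 := by
    rw [hα]
    have hℓ7 : (4 : ℝ) ^ 7 ≤ ℓ ^ 7 := pow_le_pow_left₀ (by norm_num) hℓ4 7
    have h1 : |c'| * (Real.pi / ℓ ^ 9) * ℓ = |c'| / ℓ * (Real.pi / ℓ ^ 7) := by field_simp
    rw [h1]
    have h2 : |c'| / ℓ ≤ 1 := (div_le_one hℓ0).mpr hℓc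
    calc |c'| / ℓ * (Real.pi / ℓ ^ 7) ≤ 1 * (4 / 4 ^ 7) := by gcongr
      _ = 4 / 4 ^ 7 := one_mul _
  have habs : |c' * alpha D * ℓ| = |c'| * alpha D * ℓ := by
    rw [abs_mul, abs_mul, abs_of_nonneg hα0, abs_of_pos hℓ0]
  constructor
  · have h : ‖beta1 c' D‖ = alpha D * |1 - 5 * c' * alpha D * ℓ| := by
      rw [beta1, norm_mul, norm_mul, Complex.norm_I, one_mul, Complex.norm_real, Complex.norm_real,
        Real.norm_eq_abs, Real.norm_eq_abs, abs_of_nonneg hα0, hℓ]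
    rw [h]
    have h2 : |1 - 5 * c' * alpha D * ℓ| ≤ 1 + 5 * (|c'| * alpha D * ℓ) := by
      calc |1 - 5 * c' * alpha D * ℓ| ≤ |(1 : ℝ)| + |5 * c' * alpha D * ℓ| := abs_sub _ _
        _ = 1 + 5 * (|c'| * alpha D * ℓ) := by
            rw [abs_one, show 5 * c' * alpha D * ℓ = 5 * (c' * alpha D * ℓ) by ring, abs_mul, habs]
            norm_num
    have h3 : |1 - 5 * c' * alpha D * ℓ| ≤ 1 + 5 * (4 / 4 ^ 7) := h2.trans (by linarith [hcαℓ])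
    calc alpha D * |1 - 5 * c' * alpha D * ℓ| ≤ (4 / 4 ^ 9) * (1 + 5 * (4 / 4 ^ 7)) :=
          mul_le_mul hα1 h3 (abs_nonneg _) (by norm_num)
      _ ≤ 1 := by norm_num
  · have h : ‖beta2 c' D‖ = 2 * alpha D * |1 + c' * alpha D * ℓ| := by
      rw [beta2, norm_mul, norm_mul, norm_mul, Complex.norm_I, mul_one, Complex.norm_real,
        Complex.norm_real, Real.norm_eq_abs, Real.norm_eq_abs, abs_of_nonneg hα0, hℓ]
      norm_num
    rw [h]
    have h2 : |1 + c' * alpha D * ℓ| ≤ 1 + |c'| * alpha D * ℓ := by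
      calc |1 + c' * alpha D * ℓ| ≤ |(1 : ℝ)| + |c' * alpha D * ℓ| := abs_add_le _ _
        _ = 1 + |c'| * alpha D * ℓ := by rw [abs_one, habs]
    have h3 : |1 + c' * alpha D * ℓ| ≤ 1 + 4 / 4 ^ 7 := h2.trans (by linarith [hcαℓ])
    calc 2 * alpha D * |1 + c' * alpha D * ℓ| ≤ 2 * (4 / 4 ^ 9) * (1 + 4 / 4 ^ 7) :=
          mul_le_mul (by linarith [hα1]) h3 (abs_nonneg _) (by norm_num)
      _ ≤ 1 := by norm_num

/-- **`|ℛ₁*| ≤ C𝓛²` under (A), for `D` large** (`ℛ₁* = L(1+β₁,χ)L(1+β₂,χ)δ(1)/L′(1,χ)`, §15 p. 83):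
by §15.u058 `ℛ₁* = β₁β₂L′(1,χ) + O(𝓛⁻²⁴)` (`ResidueValues.step15_u058_inputs15AB`) with `|β₁β₂| ≤ 1` and
`|L′(1,χ)| ≤ 2e^{9/2}(1+𝓛)𝓛 ≤ 4e^{9/2}𝓛²` (`Lemma31.norm_deriv_LFunction_le_near_one`).
[cite: Zhang2022LandauSiegel, §15 (15.17) p.85] -/
theorem norm_calR1star_le (c' : ℝ) :
    ∃ C : ℝ, 0 ≤ C ∧ ForAllLarge fun D _ χ => AssumptionA D χ →
      ‖calR1star c' χ‖ ≤ C * ell D ^ 2 := by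
  obtain ⟨C₅₈, h58⟩ := ResidueValues.step15_u058_inputs15AB c'
  obtain ⟨D₂, hD₂⟩ := exists_nat_ell_ge (max 4 |c'|)
  refine ⟨4 * Real.exp (9 / 2) + |C₅₈|, by positivity, ?_⟩
  have hLarge : ForAllLarge fun D _ _ => D₂ ≤ D := ForAllLarge.of_le D₂ fun D _ _ hD _ _ => hD
  refine (h58.and hLarge).mono ?_
  intro D _ χ _ hp ⟨e58, hD₂'⟩ hA
  obtain ⟨hℓ4, hℓc⟩ := max_le_iff.mp (hD₂ D hD₂')
  set ℓ := ell D with hℓ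
  have hℓ1 : 1 ≤ ℓ := by linarith
  have hℓ3 : 3 ≤ Real.log D := by show 3 ≤ ell D; linarith
  have h58' : ‖calR1star c' χ - beta1 c' D * beta2 c' D * deriv χ.LFunction 1‖ ≤ C₅₈ / ℓ ^ 24 :=
    e58 hA
  have hL' : ‖deriv χ.LFunction 1‖ ≤ 2 * Real.exp (9 / 2) * (1 + ℓ) * ℓ := by
    have h := Lemma31.norm_deriv_LFunction_le_near_one χ hℓ3 hp (w := 1)
      (by rw [sub_self, norm_zero]; positivity)
    simpa only [hℓ, ell] using h
  obtain ⟨hb1, hb2⟩ := norm_beta12_le_one c' hℓ4 hℓc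
  have hmain : ‖beta1 c' D * beta2 c' D * deriv χ.LFunction 1‖ ≤ 4 * Real.exp (9 / 2) * ℓ ^ 2 := by
    rw [norm_mul, norm_mul]
    have h1 : ‖beta1 c' D‖ * ‖beta2 c' D‖ ≤ 1 :=
      mul_le_one₀ hb1 (norm_nonneg _) hb2
    calc ‖beta1 c' D‖ * ‖beta2 c' D‖ * ‖deriv χ.LFunction 1‖
        ≤ 1 * (2 * Real.exp (9 / 2) * (1 + ℓ) * ℓ) :=
          mul_le_mul h1 hL' (norm_nonneg _) zero_le_one
      _ ≤ 4 * Real.exp (9 / 2) * ℓ ^ 2 := by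
          have hq : (1 + ℓ) * ℓ ≤ 2 * ℓ ^ 2 := by nlinarith
          have he : 0 ≤ 2 * Real.exp (9 / 2) := by positivity
          calc 1 * (2 * Real.exp (9 / 2) * (1 + ℓ) * ℓ) = 2 * Real.exp (9 / 2) * ((1 + ℓ) * ℓ) := by ring
            _ ≤ 2 * Real.exp (9 / 2) * (2 * ℓ ^ 2) := mul_le_mul_of_nonneg_left hq he
            _ = 4 * Real.exp (9 / 2) * ℓ ^ 2 := by ring
  have herr : C₅₈ / ℓ ^ 24 ≤ |C₅₈| * ℓ ^ 2 := by
    have hpow : 1 ≤ ℓ ^ 24 := one_le_pow₀ hℓ1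
    calc C₅₈ / ℓ ^ 24 ≤ |C₅₈| / ℓ ^ 24 := by gcongr; exact le_abs_self _
      _ ≤ |C₅₈| := div_le_self (abs_nonneg _) hpow
      _ ≤ |C₅₈| * ℓ ^ 2 := le_mul_of_one_le_right (abs_nonneg _) (one_le_pow₀ hℓ1)
  calc ‖calR1star c' χ‖
      = ‖(calR1star c' χ - beta1 c' D * beta2 c' D * deriv χ.LFunction 1) +
          beta1 c' D * beta2 c' D * deriv χ.LFunction 1‖ := by rw [sub_add_cancel]
    _ ≤ ‖calR1star c' χ - beta1 c' D * beta2 c' D * deriv χ.LFunction 1‖ +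
          ‖beta1 c' D * beta2 c' D * deriv χ.LFunction 1‖ := norm_add_le _ _
    _ ≤ |C₅₈| * ℓ ^ 2 + 4 * Real.exp (9 / 2) * ℓ ^ 2 := add_le_add (h58'.trans herr) hmain
    _ = (4 * Real.exp (9 / 2) + |C₅₈|) * ℓ ^ 2 := by ring

/-- **`|ℛ₁*| ≤ C𝓛ᵏ`** — the `∃ C k` form used as the size hypothesis of the (15.17) assembly edge.
[cite: Zhang2022LandauSiegel, §15 (15.17) p.85] -/
theorem norm_calR1star_le_pow (c' : ℝ) :
    ∃ C : ℝ, ∃ k : ℕ, ForAllLarge fun D _ χ => AssumptionA D χ →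
      ‖calR1star c' χ‖ ≤ C * ell D ^ k := by
  obtain ⟨C, -, h⟩ := norm_calR1star_le c'
  exact ⟨C, 2, h⟩

end Literature.NumberTheory.LFunctions.Zhang2022.Typed.Section15A

end
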